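import Summits.AtomisticToContinuum.BoseEinsteinCondensation.Theorems.BECThomsonPrincipleFibreConductanceConditionalDefs
import Summits.AtomisticToContinuum.BoseEinsteinCondensation.Theorems.BECThomsonPrincipleFibreConductanceStubBottomMode
import HarnessLib

/-!
# Line `strategist-split` — crux `FibreConductance` (stmt-AtomisticToContinuum-9480), route `BECThomsonPrinciple`

Crux-strategist WALL-BREAKER line (unit `cstrat-stmt-AtomisticToContinuum-9480-p1`; card `Lines/strategist-split.md`;
census `STRATEGY-CENSUS.md`; glue module `Cruxes/FibreConductance/StrategistSplit.lean`).  The skeleton IS the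
strategist's decomposition D1, registered as a line because `route edit --split` is available to a seat on its
FINAL cycle only: the lead seated on this line drives stubs 1–2 (landscape, local: NEW statements, no uniform-
location hole moment, no occupation number), reshapes stub 3 (landscape, coarse, conditional on the IR input),
treats stub 4 (the IR input, = the landed `ShellOccupation` VERBATIM) as an ITEM-IN-WAITING — never as a stub to
prove inside the line (its necessity is p90785, its only known source is crux 9479, census §0/S5) — and, on its
final cycle, files the prepared split (`StrategistSplitChildren.md` = children.json; command in the card).

Stubs (4) and composition:
* `stub_cubePoincareMoment` (OPEN, landscape input, L): the bath-averaged, volume-averaged weighted Neumann–Poincaré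
  constant of the conditional law `ψ²(·|X̂)dy` on the cubes of side `ℓ = L/(ν+1)` is `≤ A ℓ²` for every block count
  with `ν + 1 ≤ M√ρ L/2π` (all wavelength tilings of the window), for exact zero-free minimisers of bounded `v`.
* `stub_localOfCubePoincare` (DETERMINISTIC, M/L): `CubePoincareMoment → Children.LocalFibreConductance` — per fibre
  `|∫_cell q_loc f|² ≤ 4⟨C_P⟩_Q · ∫|∇f|²ψ²` (cube-neutrality of `q_loc`, Cauchy–Schwarz, `∫_Q|q_loc|²/ψ² ≤ 4L⁻³|Q|`
  from `|A_Q|² ≤ |Q|μ_Q`), then Cauchy–Schwarz over the bath with weights `W`, `1/W`; `ℓ² = L²/‖n‖²` because the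
  crux's norm is the sup norm and `waveBlocks n + 1 = ‖n‖_∞`.
* `stub_coarseBeatConductance` (OPEN, landscape-coarse given IR, L): `Children.CoarseBeatConductance`
  (`= ShellOccupation → ConditionalLawPoincare.CoarseBeatDualBound`, `Iff.rfl`): lattice `H⁻¹` of the cube charges.
* `stub_halfShellOccupation` (IR INPUT; item-in-waiting): `Children.HalfShellOccupation` (`= ShellOccupation`, `Iff.rfl`).
* `fibreConductance_of_registered_stubs` / `FibreConductance_of` (kernel-checked): the four stubs imply the crux BY
  NAME via the strategist's glue `cruxDualBound_of_local_coarse` (= `StrategistSplit.lean` §C) and the landed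
  Thomson realisation `fibreConductance_of_cruxDualBound`.

Disproof v7 obligations: (H1) exact minimality is bound by stubs 1, 3, 4 (`not_fibreConductanceNearMinimiser`
p75366; `not_shellOccupationNearMinimiser` p77197); §Tight/§E floor `1/4π²` respected (free gas: `q_c ≡ 0`, stub 1's
free value `A = 4/π²·…` ≥ the floor); §Infrared honoured AT stub 4 (the line does not hide the IR content anywhere
else: stubs 1–3 hold in the fully localised no-BEC scenario); no stub is an instance of a landed Negative lemma
(`CondensateFloor` p125262 concerns uniform-location moments — none here; `SlabGradient*`, `DensityFlattening*NearMinimiser`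
concern (H1)-relaxed statements — all stubs keep (H1)).
-/

noncomputable section

/-! ## §A The three children (VERBATIM the bodies of `StrategistSplitChildren.md` = children.json; same short names as
the future route-file decls, namespace `…StrategistSplitLine.Children`; = `Cruxes/FibreConductance/StrategistSplit.lean` §A,
repeated here so that the skeleton imports landed Theorems modules only). -/

namespace Summit.AtomisticToContinuum.BoseEinsteinCondensation.Cruxes.FibreConductance.StrategistSplitLine.Children

/-! The three children carry here EXACTLY the decl names and bodies the split installs in the route file
(`Theses.BECThomsonPrinciple.{HalfShellOccupation, LocalFibreConductance, CoarseBeatConductance}`), but live in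
the namespace `…Cruxes.FibreConductance.StrategistSplitLine.Children` so that this module keeps compiling after the
gate has written the route-file decls (no duplicate declarations); the prover's Theorems file then proves
`Theses.….LocalFibreConductance → … → FibreConductance` by `StrategistSplit.fibreConductance_of_subs` (defeq,
identical bodies) or by `fibreConductance_of_named` with the `Iff.rfl` casts of §B. -/

/-- Child 3 (INFRARED input; = `ParsevalShellBootstrap.ShellOccupation` verbatim). -/
def HalfShellOccupation : Prop :=
  ∀ v : ℝ → ENNReal, Literature.MathematicalPhysics.QuantumManyBody.BoseGas.IsRepulsiveFiniteRange v → (∃ B : ℝ, ∀ r, v r ≤ ENNReal.ofReal B) → ∀ M : ℝ, 0 < M → ∃ θ ρ₀ K : ℝ, 0 < θ ∧ 0 < ρ₀ ∧ 0 < K ∧ ∃ N₀ : ℕ, ∀ m : ℕ, N₀ ≤ m + 1 → ∀ L : ℝ, 0 < L → ((m + 1 : ℕ) : ℝ) ≤ ρ₀ * L ^ 3 → ∀ n : Fin 3 → ℤ, n ≠ 0 → 2 * Real.pi * ‖(fun j => (n j : ℝ))‖ / L ≤ M * Real.sqrt ((m + 1 : ℕ) / L ^ 3) → ∀ Φ :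 Literature.MathematicalPhysics.QuantumManyBody.BoseGas.PeriodicTrialState (m + 1) L, Literature.MathematicalPhysics.QuantumManyBody.BoseGas.periodicEnergy v Φ = Literature.MathematicalPhysics.QuantumManyBody.BoseGas.periodicGroundStateEnergy v (m + 1) L → (∀ X, Φ.ψ X ≠ 0) → ∀ p₁ : ℝ, 0 < p₁ → p₁ ≤ θ * Real.sqrt ((m + 1 : ℕ) / L ^ 3) * L / (2 * Real.pi) → p₁ ≤ ‖(fun j => (n j : ℝ))‖ / 2 → ∀ p : Fin 3 → ℤ, ‖(fun j => ((p j + n j : ℤ) : ℝ))‖ < p₁ → Literature.MathematicalPhysics.QuantumManyBody.BoseGas.cellOccupation (m + 1) L (Literature.MathematicalPhysics.QuantumManyBody.BoseGas.planeWaveMode L p) (fun X => (‖Φ.ψ X‖ : ℂ)) ≤ ENNReal.ofReal (K * (m + 1 : ℕ) / (‖(fun j => (n j : ℝ))‖ ^ 2 * p₁))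

/-- Child 1 (LANDSCAPE, local): the local part of the fibre charge on the wavelength tiling has fibre
dual bound `A L²/‖n‖²` (difference-of-pairings form). -/
def LocalFibreConductance : Prop :=
  ∀ v : ℝ → ENNReal, Literature.MathematicalPhysics.QuantumManyBody.BoseGas.IsRepulsiveFiniteRange v → (∃ B : ℝ, ∀ r, v r ≤ ENNReal.ofReal B) → ∀ M : ℝ, 0 < M → ∃ ρ₀ A : ℝ, 0 < ρ₀ ∧ 0 < A ∧ ∃ N₀ : ℕ, ∀ m : ℕ, N₀ ≤ m + 1 → ∀ L : ℝ, 0 < L → ((m + 1 : ℕ) : ℝ) ≤ ρ₀ * L ^ 3 → ∀ n : Fin 3 → ℤ, n ≠ 0 → 2 * Real.pi * ‖(fun j => (n j : ℝ))‖ / L ≤ M * Real.sqrt ((m + 1 : ℕ) / L ^ 3) → ∀ Φ : Literature.MathematicalPhysics.QuantumManyBody.BoseGas.PeriodicTrialState (m + 1) L, Literature.MathematicalPhysics.QuantumManyBody.BoseGas.periodicEnergy v Φ = Literature.MathematicalPhysics.QuantumManyBody.BoseGas.periodicGroundStateEnergy v (m + 1) L → (∀ X, Φ.ψ X ≠ 0)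 → let W : Literature.MathematicalPhysics.QuantumManyBody.BoseGas.Config (m + 1) → ℝ := fun X => ∫ y in Literature.MathematicalPhysics.QuantumManyBody.BoseGas.cell L, ‖Φ.ψ (Function.update X 0 y)‖ ^ 2; let ψ : Literature.MathematicalPhysics.QuantumManyBody.BoseGas.Config (m + 1) → ℝ := fun X => ‖Φ.ψ X‖ / Real.sqrt (W X); let β : Literature.MathematicalPhysics.QuantumManyBody.BoseGas.Config (m + 1) → ℂ := fun X => ∫ y in Literature.MathematicalPhysics.QuantumManyBody.BoseGas.cell L, Complex.exp (Complex.I * ↑(2 * Real.pi / L * ∑ j, (n j : ℝ) * y j)) * (ψ (Function.update X 0 y) : ℂ); let q : Literature.MathematicalPhysics.QuantumManyBody.BoseGas.Config (m + 1) → ℂ := fun X => ((Real.sqrt (L ^ 3))⁻¹ : ℂ) * (Complex.exp (Complex.I * ↑(2 * Real.pi / L * ∑ j, (n j : ℝ) * X 0 j)) * (ψ X : ℂ) - β X * (ψ X : ℂ) ^ 2); let ν : ℕ := (Finset.univ.sup fun j => (n j).natAbs) - 1; let s : ℝ := L / (ν + 1); let cube : (Fin 3 → Fin (ν + 1)) →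 Set Literature.MathematicalPhysics.QuantumManyBody.BoseGas.Space := fun Q => {y | ∀ l, y l ∈ Set.Ico (((Q l : ℕ) : ℝ) * s) ((((Q l : ℕ) : ℝ) + 1) * s)}; let idx : Literature.MathematicalPhysics.QuantumManyBody.BoseGas.Space → (Fin 3 → Fin (ν + 1)) := fun y l => ⟨min ν ⌊y l / s⌋₊, Nat.lt_succ_of_le (min_le_left _ _)⟩; let qc : Literature.MathematicalPhysics.QuantumManyBody.BoseGas.Config (m + 1) → ℂ := fun X => ((ψ X ^ 2 : ℝ) : ℂ) * ((∫ y in cube (idx (X 0)), q (Function.update X 0 y)) / ((∫ y in cube (idx (X 0)), ψ (Function.update X 0 y) ^ 2 : ℝ) : ℂ)); ∀ η : Literature.MathematicalPhysics.QuantumManyBody.BoseGas.Config (m + 1) → ℂ, (ContDiff ℝ 1 η ∧ ∀ (X : Literature.MathematicalPhysics.QuantumManyBody.BoseGas.Config (m + 1)) (i : Fin (m + 1)) (l : Fin 3), η (X + Pi.single i (EuclideanSpace.single l L)) = η X) → ENNReal.ofReal (‖(∫ X in Literature.MathematicalPhysics.QuantumManyBody.BoseGas.cellN (m + 1) L, q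 X * η X) - ∫ X in Literature.MathematicalPhysics.QuantumManyBody.BoseGas.cellN (m + 1) L, qc X * η X‖ ^ 2) ≤ ENNReal.ofReal (A * L ^ 2 / ‖(fun j => (n j : ℝ))‖ ^ 2) * ∫⁻ X in Literature.MathematicalPhysics.QuantumManyBody.BoseGas.cellN (m + 1) L, ENNReal.ofReal ((∑ l : Fin 3, ‖fderiv ℝ η X (Pi.single 0 (EuclideanSpace.single l (1 : ℝ)))‖ ^ 2) * (ψ X ^ 2 / W X))

/-- Child 2 (LANDSCAPE, coarse; conditional on child 3): the half-shell occupation input implies the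
fibre dual bound `B L²/‖n‖²` of the coarse (block) part of the charge, for `‖n‖_∞ ≥ 2`. -/
def CoarseBeatConductance : Prop :=
  (∀ v : ℝ → ENNReal, Literature.MathematicalPhysics.QuantumManyBody.BoseGas.IsRepulsiveFiniteRange v → (∃ B : ℝ, ∀ r, v r ≤ ENNReal.ofReal B) → ∀ M : ℝ, 0 < M → ∃ θ ρ₀ K : ℝ, 0 < θ ∧ 0 < ρ₀ ∧ 0 < K ∧ ∃ N₀ : ℕ, ∀ m : ℕ, N₀ ≤ m + 1 → ∀ L : ℝ, 0 < L → ((m + 1 : ℕ) : ℝ) ≤ ρ₀ * L ^ 3 → ∀ n : Fin 3 → ℤ, n ≠ 0 → 2 * Real.pi * ‖(fun j => (n j : ℝ))‖ / L ≤ M * Real.sqrt ((m + 1 : ℕ) / L ^ 3) → ∀ Φ : Literature.MathematicalPhysics.QuantumManyBody.BoseGas.PeriodicTrialState (m + 1) L, Literature.MathematicalPhysics.QuantumManyBody.BoseGas.periodicEnergy v Φ = Literature.MathematicalPhysics.QuantumManyBody.BoseGas.periodicGroundStateEnergy v (m + 1) L → (∀ X, Φ.ψ X ≠ 0) → ∀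 p₁ : ℝ, 0 < p₁ → p₁ ≤ θ * Real.sqrt ((m + 1 : ℕ) / L ^ 3) * L / (2 * Real.pi) → p₁ ≤ ‖(fun j => (n j : ℝ))‖ / 2 → ∀ p : Fin 3 → ℤ, ‖(fun j => ((p j + n j : ℤ) : ℝ))‖ < p₁ → Literature.MathematicalPhysics.QuantumManyBody.BoseGas.cellOccupation (m + 1) L (Literature.MathematicalPhysics.QuantumManyBody.BoseGas.planeWaveMode L p) (fun X => (‖Φ.ψ X‖ : ℂ)) ≤ ENNReal.ofReal (K * (m + 1 : ℕ) / (‖(fun j => (n j : ℝ))‖ ^ 2 * p₁))) → ∀ v : ℝ → ENNReal, Literature.MathematicalPhysics.QuantumManyBody.BoseGas.IsRepulsiveFiniteRange v → (∃ B : ℝ, ∀ r, v r ≤ ENNReal.ofReal B) → ∀ M : ℝ, 0 < M → ∃ ρ₀ B : ℝ, 0 < ρ₀ ∧ 0 < B ∧ ∃ N₀ : ℕ, ∀ m : ℕ, N₀ ≤ m + 1 → ∀ L : ℝ, 0 < L → ((m + 1 : ℕ) : ℝ) ≤ ρ₀ * L ^ 3 → ∀ n : Fin 3 → ℤ, n ≠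 0 → 2 * Real.pi * ‖(fun j => (n j : ℝ))‖ / L ≤ M * Real.sqrt ((m + 1 : ℕ) / L ^ 3) → ∀ Φ : Literature.MathematicalPhysics.QuantumManyBody.BoseGas.PeriodicTrialState (m + 1) L, Literature.MathematicalPhysics.QuantumManyBody.BoseGas.periodicEnergy v Φ = Literature.MathematicalPhysics.QuantumManyBody.BoseGas.periodicGroundStateEnergy v (m + 1) L → (∀ X, Φ.ψ X ≠ 0) → 2 ≤ (Finset.univ.sup fun j => (n j).natAbs) → let W : Literature.MathematicalPhysics.QuantumManyBody.BoseGas.Config (m + 1) → ℝ := fun X => ∫ y in Literature.MathematicalPhysics.QuantumManyBody.BoseGas.cell L, ‖Φ.ψ (Function.update X 0 y)‖ ^ 2; let ψ : Literature.MathematicalPhysics.QuantumManyBody.BoseGas.Config (m + 1) → ℝ := fun X => ‖Φ.ψ X‖ / Real.sqrt (W X); let β : Literature.MathematicalPhysics.QuantumManyBody.BoseGas.Config (m + 1) → ℂ := fun X => ∫ y in Literature.MathematicalPhysics.QuantumManyBody.BoseGas.cell L, Complex.exp (Complex.I * ↑(2 * Real.pi / L * ∑ j, (n j : ℝ) * y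 j)) * (ψ (Function.update X 0 y) : ℂ); let q : Literature.MathematicalPhysics.QuantumManyBody.BoseGas.Config (m + 1) → ℂ := fun X => ((Real.sqrt (L ^ 3))⁻¹ : ℂ) * (Complex.exp (Complex.I * ↑(2 * Real.pi / L * ∑ j, (n j : ℝ) * X 0 j)) * (ψ X : ℂ) - β X * (ψ X : ℂ) ^ 2); let ν : ℕ := (Finset.univ.sup fun j => (n j).natAbs) - 1; let s : ℝ := L / (ν + 1); let cube : (Fin 3 → Fin (ν + 1)) → Set Literature.MathematicalPhysics.QuantumManyBody.BoseGas.Space := fun Q => {y | ∀ l, y l ∈ Set.Ico (((Q l : ℕ) : ℝ) * s) ((((Q l : ℕ) : ℝ) + 1) * s)}; let idx : Literature.MathematicalPhysics.QuantumManyBody.BoseGas.Space → (Fin 3 → Fin (ν + 1)) := fun y l => ⟨min ν ⌊y l / s⌋₊, Nat.lt_succ_of_le (min_le_left _ _)⟩; let qc : Literature.MathematicalPhysics.QuantumManyBody.BoseGas.Config (m + 1) → ℂ := fun X => ((ψ X ^ 2 : ℝ) : ℂ) * ((∫ y in cube (idx (X 0)), q (Function.update X 0 y)) / ((∫ y in cube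 (idx (X 0)), ψ (Function.update X 0 y) ^ 2 : ℝ) : ℂ)); ∀ η : Literature.MathematicalPhysics.QuantumManyBody.BoseGas.Config (m + 1) → ℂ, (ContDiff ℝ 1 η ∧ ∀ (X : Literature.MathematicalPhysics.QuantumManyBody.BoseGas.Config (m + 1)) (i : Fin (m + 1)) (l : Fin 3), η (X + Pi.single i (EuclideanSpace.single l L)) = η X) → ENNReal.ofReal (‖∫ X in Literature.MathematicalPhysics.QuantumManyBody.BoseGas.cellN (m + 1) L, qc X * η X‖ ^ 2) ≤ ENNReal.ofReal (B * L ^ 2 / ‖(fun j => (n j : ℝ))‖ ^ 2) * ∫⁻ X in Literature.MathematicalPhysics.QuantumManyBody.BoseGas.cellN (m + 1) L, ENNReal.ofReal ((∑ l : Fin 3, ‖fderiv ℝ η X (Pi.single 0 (EuclideanSpace.single l (1 : ℝ)))‖ ^ 2) * (ψ X ^ 2 / W X))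

end Summit.AtomisticToContinuum.BoseEinsteinCondensation.Cruxes.FibreConductance.StrategistSplitLine.Children

namespace Summit.AtomisticToContinuum.BoseEinsteinCondensation.Cruxes.FibreConductance.StrategistSplitLine

open MeasureTheory
open scoped ENNReal
open Literature.MathematicalPhysics.QuantumManyBody.BoseGas
open Summit.AtomisticToContinuum.BoseEinsteinCondensation.Theses.BECThomsonPrinciple (FibreConductance)
open Summit.AtomisticToContinuum.BoseEinsteinCondensation.Cruxes.FibreConductance.ParsevalShellBootstrap
open Summit.AtomisticToContinuum.BoseEinsteinCondensation.Cruxes.FibreConductance.HealingSplitKineticDefect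
open Summit.AtomisticToContinuum.BoseEinsteinCondensation.Cruxes.FibreConductance.ConditionalLawPoincare
open Summit.AtomisticToContinuum.BoseEinsteinCondensation.Cruxes.FibreConductance.StrategistSplitLine.Children
  (HalfShellOccupation LocalFibreConductance CoarseBeatConductance)

variable {m : ℕ} {L : ℝ}
/-! ## §B The strategist's glue (= `Cruxes/FibreConductance/StrategistSplit.lean` §B–§C, repeated for self-containment) -/


/-- LOCAL DIFFERENCE BOUND (child 1 over the landed vocabulary): in the crux's window, for exact
zero-free minimisers, `‖∫qη − ∫q_cη‖² ≤ (A L²/‖n‖²)·E(η)` for every test `η`, `q_c` the coarse part of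
the crux's charge on the wavelength tiling. [folklore] -/
def LocalDiffBound : Prop :=
  LowDensityWindow fun m L n Φ A =>
    ∀ η : Config (m + 1) → ℂ, IsTest L η →
      ENNReal.ofReal (‖(∫ X in cellN (m + 1) L, cruxCharge n Φ X * η X) -
          ∫ X in cellN (m + 1) L, coarseOf L (waveBlocks n) Φ (cruxCharge n Φ) X * η X‖ ^ 2) ≤
        ENNReal.ofReal (A * L ^ 2 / ‖(fun j => (n j : ℝ))‖ ^ 2) * dualEnergy Φ η

/-- Readback: child 1 IS `LocalDiffBound`. [folklore] -/
theorem localFibreConductance_iff : LocalFibreConductance ↔ LocalDiffBound := Iff.rfl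

/-- Readback: child 3 IS the landed `ShellOccupation`. [folklore] -/
theorem halfShellOccupation_iff : HalfShellOccupation ↔ ShellOccupation := Iff.rfl

/-- Readback: child 2 IS `ShellOccupation → CoarseBeatDualBound`. [folklore] -/
theorem coarseBeatConductance_iff :
    CoarseBeatConductance ↔ (ShellOccupation → CoarseBeatDualBound) := Iff.rfl

/-! ## §C  The glue -/

/-- `ℝ≥0∞` bookkeeping: `2·ofReal(Au) + 2·ofReal(Bu) = ofReal((2A+2B)u)` for `A, B, u ≥ 0`. [folklore] -/
theorem two_ofReal_add_two_ofReal {A B u : ℝ} (hA : 0 ≤ A) (hB : 0 ≤ B) (hu : 0 ≤ u) :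
    2 * ENNReal.ofReal (A * u) + 2 * ENNReal.ofReal (B * u) = ENNReal.ofReal ((2 * A + 2 * B) * u) := by
  rw [← ENNReal.ofReal_ofNat 2, ← ENNReal.ofReal_mul (by norm_num), ← ENNReal.ofReal_mul (by norm_num),
    ← ENNReal.ofReal_add (by positivity) (by positivity)]
  congr 1
  ring

/-- `‖I‖² ≤ 2‖I − J‖² + 2‖J‖²` in `ℝ≥0∞`. [folklore] -/
theorem ofReal_norm_sq_le_of_sub (I J : ℂ) :
    ENNReal.ofReal (‖I‖ ^ 2) ≤ 2 * ENNReal.ofReal (‖I - J‖ ^ 2) + 2 * ENNReal.ofReal (‖J‖ ^ 2) := by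
  have h2 : (2 : ℝ≥0∞) = ENNReal.ofReal 2 := by norm_num
  rw [h2, ← ENNReal.ofReal_mul zero_le_two, ← ENNReal.ofReal_mul zero_le_two,
    ← ENNReal.ofReal_add (by positivity) (by positivity)]
  refine ENNReal.ofReal_le_ofReal ?_
  have e : I = (I - J) + J := (sub_add_cancel I J).symm
  have hn : ‖I‖ ≤ ‖I - J‖ + ‖J‖ := by
    calc ‖I‖ = ‖(I - J) + J‖ := by rw [← e]
      _ ≤ ‖I - J‖ + ‖J‖ := norm_add_le _ _
  nlinarith [hn, norm_nonneg I, norm_nonneg (I - J), norm_nonneg J, sq_nonneg (‖I - J‖ - ‖J‖)]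

/-- **The crux's dual bound from the local difference bound and the coarse beat dual bound**
(`ρ₀ = min`, `N₀ = max`, `C = 2A + 2B`; at `‖n‖_∞ = 1` the coarse charge vanishes identically by the
landed `bottomMode_neutral`). [folklore] -/
theorem cruxDualBound_of_local_coarse (hloc : LocalDiffBound) (hcb : CoarseBeatDualBound) :
    CruxDualBound := by
  intro v hv hbdd M hM
  obtain ⟨ρ₁, A, hρ₁, hA, N₁, h₁⟩ := hloc v hv hbdd M hM
  obtain ⟨ρ₂, B, hρ₂, hB, N₂, h₂⟩ := hcb v hv hbdd M hM
  refine ⟨min ρ₁ ρ₂, 2 * A + 2 * B, lt_min hρ₁ hρ₂, by positivity, max N₁ N₂, ?_⟩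
  intro m hm L hL hρ n hn hwin Φ hE hΦ η hη
  have hL3 : (0 : ℝ) ≤ L ^ 3 := by positivity
  have hρ₁' : ((m + 1 : ℕ) : ℝ) ≤ ρ₁ * L ^ 3 :=
    hρ.trans (mul_le_mul_of_nonneg_right (min_le_left _ _) hL3)
  have hρ₂' : ((m + 1 : ℕ) : ℝ) ≤ ρ₂ * L ^ 3 :=
    hρ.trans (mul_le_mul_of_nonneg_right (min_le_right _ _) hL3)
  have hu : 0 ≤ L ^ 2 / ‖(fun j => (n j : ℝ))‖ ^ 2 := by positivity
  set u : ℝ := L ^ 2 / ‖(fun j => (n j : ℝ))‖ ^ 2 with hu_def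
  set I : ℂ := ∫ X in cellN (m + 1) L, cruxCharge n Φ X * η X with hI
  set J : ℂ := ∫ X in cellN (m + 1) L, coarseOf L (waveBlocks n) Φ (cruxCharge n Φ) X * η X with hJ
  -- the local part
  have hlocal : ENNReal.ofReal (‖I - J‖ ^ 2) ≤ ENNReal.ofReal (A * u) * dualEnergy Φ η := by
    have h := h₁ m (le_of_max_le_left hm) L hL hρ₁' n hn hwin Φ hE hΦ η hη
    rwa [hu_def, ← mul_div_assoc]
  -- the coarse part: zero at the bottom modes, `hcb` above
  have hcoarse : ENNReal.ofReal (‖J‖ ^ 2) ≤ ENNReal.ofReal (B * u) * dualEnergy Φ η := by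
    rcases Nat.lt_or_ge (supIdx n) 2 with hlt | hge
    · have h1 : supIdx n = 1 := le_antisymm (Nat.lt_succ_iff.mp hlt) (one_le_supIdx hn)
      have hz : ∀ X, coarseOf L (waveBlocks n) Φ (cruxCharge n Φ) X = 0 := by
        rw [waveBlocks_eq_zero h1]
        exact coarseOf_cruxCharge_zero_eq_zero bottomMode_neutral hL n Φ hΦ
      have hJ0 : J = 0 := by
        rw [hJ]
        simp [hz]
      rw [hJ0]
      simp
    · have h := h₂ m (le_of_max_le_right hm) L hL hρ₂' n hn hwin Φ hE hΦ hge η hη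
      rwa [hu_def, ← mul_div_assoc]
  calc ENNReal.ofReal (‖I‖ ^ 2)
      ≤ 2 * ENNReal.ofReal (‖I - J‖ ^ 2) + 2 * ENNReal.ofReal (‖J‖ ^ 2) := ofReal_norm_sq_le_of_sub I J
    _ ≤ 2 * (ENNReal.ofReal (A * u) * dualEnergy Φ η) + 2 * (ENNReal.ofReal (B * u) * dualEnergy Φ η) := by
        gcongr
    _ = (2 * ENNReal.ofReal (A * u) + 2 * ENNReal.ofReal (B * u)) * dualEnergy Φ η := by ring
    _ = ENNReal.ofReal ((2 * A + 2 * B) * u) * dualEnergy Φ η := by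
        rw [two_ofReal_add_two_ofReal hA.le hB.le hu]
    _ = ENNReal.ofReal ((2 * A + 2 * B) * L ^ 2 / ‖(fun j => (n j : ℝ))‖ ^ 2) * dualEnergy Φ η := by
        rw [hu_def, mul_div_assoc]

/-! ## §0 Vocabulary of the landscape input (over the landed `HealingDefs` / `ConditionalDefs` objects) -/

/-- `μ`-weighted cube average `⟨η⟩_{μ,Q}(X̂) = μ_Q⁻¹ ∫_Q η(y,X̂) ψ(y|X̂)² dy` of a configuration-space function along
the fibre through `X`. [folklore] -/
def muAvg (L : ℝ) (ν : ℕ) (Φ : PeriodicTrialState (m + 1) L) (Q : Fin 3 → Fin (ν + 1))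
    (η : Config (m + 1) → ℂ) (X : Config (m + 1)) : ℂ :=
  (∫ y in cubeSet L ν Q, η (Function.update X 0 y) * ((fibrePsi Φ (Function.update X 0 y) ^ 2 : ℝ) : ℂ)) /
    ((cubeMass L ν Φ Q X : ℝ) : ℂ)

/-- WEIGHTED NEUMANN–POINCARÉ CONSTANT `C_P(Q; ψ²(·|X̂))` of the conditional law of particle `0` on the cube `Q` of the
fibre through `X`: the supremum over `C¹` functions `η` of `∫_Q |η − ⟨η⟩_{μ,Q}|² ψ² dy / ∫_Q |∇₀η|² ψ² dy`
(`ℝ≥0∞`-valued; `0/0 = 0` for functions constant on `Q`; flat weight: `ℓ²/π²`). [folklore] -/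
def cubePoincare (L : ℝ) (ν : ℕ) (Φ : PeriodicTrialState (m + 1) L) (Q : Fin 3 → Fin (ν + 1))
    (X : Config (m + 1)) : ℝ≥0∞ :=
  ⨆ (η : Config (m + 1) → ℂ) (_ : ContDiff ℝ 1 η),
    ENNReal.ofReal (∫ y in cubeSet L ν Q,
        ‖η (Function.update X 0 y) - muAvg L ν Φ Q η X‖ ^ 2 * fibrePsi Φ (Function.update X 0 y) ^ 2) /
      ENNReal.ofReal (locEnergy Φ (cubeSet L ν Q) η X)

/-- **Statement of `stub_cubePoincareMoment` — THE LANDSCAPE INPUT (OPEN; L; uses (H1)).** For bounded repulsive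
finite-range `v` and window `M` there are `ρ₀, A, N₀` such that for every exact zero-free minimiser in the dilute
regime and EVERY block count `ν` with `ν + 1 ≤ M√ρ L/2π` (all wavelength tilings of window data), the bath-averaged
volume-averaged cube Poincaré constant is at most `A ℓ²`, `ℓ = side L ν`:
`E_W[Σ_Q (|Q|/L³)·C_P(Q; ψ²)] = L⁻³ ∫_{cellN} (Σ_Q (ℓ³/L³) C_P(Q,X)) W dX ≤ A ℓ²`.  Content: only CAGES INSIDE a cube
(closed low-`ψ` shells enclosing conditional mass, both sides massive) raise `C_P(Q)` above `≍ ℓ²`; point dips are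
capacity-negligible in `d = 3`; in the fully localised no-BEC scenario (bump of width `ξ`, log-concave tails) every
restriction `ψ²|_Q` is log-concave with variance `≤ ξ²`, so the bound holds with `A = O(M²ρξ²)` — NOT BEC-strength,
not a uniform-location hole moment (contrast `ConditionalDensityMoments` ⇒ BEC, p125262). Inputs foreseen: a `T = 0`
quantum Ruelle bound for the local bath number (LocalNumberExpMoments; Park1985 is `T > 0`), the Cameron–Martin
shift-Harnack for particle `0` (gen-1 `ShiftHarnack`), relative cage suppression by the `K`-body subsolution
inequality (marginal-subsolution-shells D7), GKZ/Barlow percolation Poincaré for the cube geometry. Why it might fail: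
needs Born-average control of closed shells for the EXACT ground state's conditional law, no print source; (H1) is
load-bearing (slab witnesses p75366 violate it at `ν = 0`); a Lifshitz-localised conditional amplitude of width
`(log L)^{1/3}` (frozen-bath toy) would break it logarithmically. (Refs: LyonsPeres2016 Ch. 2; GrimmettKestenZhang1993;
Sznitman1998 Ch. 4; Park1985; LSSY2005.) -/
def CubePoincareMoment : Prop :=
  ∀ v : ℝ → ℝ≥0∞, IsRepulsiveFiniteRange v → (∃ B : ℝ, ∀ r, v r ≤ ENNReal.ofReal B) →
    ∀ M : ℝ, 0 < M → ∃ ρ₀ A : ℝ, 0 < ρ₀ ∧ 0 < A ∧ ∃ N₀ : ℕ, ∀ m : ℕ, N₀ ≤ m + 1 →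
      ∀ L : ℝ, 0 < L → ((m + 1 : ℕ) : ℝ) ≤ ρ₀ * L ^ 3 →
        ∀ ν : ℕ, ((ν : ℝ) + 1) ≤ M * Real.sqrt ((m + 1 : ℕ) / L ^ 3) * L / (2 * Real.pi) →
          ∀ Φ : PeriodicTrialState (m + 1) L,
            periodicEnergy v Φ = periodicGroundStateEnergy v (m + 1) L → (∀ X, Φ.ψ X ≠ 0) →
              (ENNReal.ofReal L ^ 3)⁻¹ *
                  ∫⁻ X in cellN (m + 1) L,
                    (∑ Q : Fin 3 → Fin (ν + 1),
                        ENNReal.ofReal (side L ν ^ 3 / L ^ 3) * cubePoincare L ν Φ Q X) *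
                      ENNReal.ofReal (fibreW Φ X) ≤
                ENNReal.ofReal (A * side L ν ^ 2)

/-! ## §1 Registered stubs -/

/-- **stub 1 — `stub_cubePoincareMoment` (OPEN landscape input; see `CubePoincareMoment`).** -/
theorem stub_cubePoincareMoment : CubePoincareMoment := by
  sorry

/-- **stub 2 — `stub_localOfCubePoincare` (DETERMINISTIC, M/L): the cube-Poincaré moment gives the LOCAL child.**
`CubePoincareMoment → Children.LocalFibreConductance` (the latter `= StrategistSplit.LocalDiffBound` by `Iff.rfl`).
Plan: (i) both pairings exist (q continuous ⇒ integrable on `cellN`; `q_c = ψ²c_Q/μ_Q` bounded and measurable,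
piecewise along `cubeIdx`), so the difference is `∫ q_loc η`; (ii) per fibre, cube-neutrality `∫_Q q_loc dy = 0`
lets one subtract `⟨η⟩_{μ,Q}` on each cube; Cauchy–Schwarz with `∫_Q |q_loc|²/ψ² ≤ 4L⁻³|Q|` (`q_loc =
L^{-3/2}(e_nψ − ψ²A_Q/μ_Q)`, `|A_Q|² ≤ |Q|μ_Q`) and the definition of `cubePoincare` give
`|∫_cell q_loc η dy|² ≤ 4(Σ_Q (|Q|/L³)C_P(Q)) · ∫_cell |∇₀η|²ψ² dy`; (iii) Cauchy–Schwarz over the bath with weights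
`W`, `1/W` (c1's `high_sq_le` pattern) gives `‖∫ q_loc η‖² ≤ 4 E_W[⟨C_P⟩] · dualEnergy`, and `4·(A/4)… ≤ A ℓ²` with
`ℓ = side L (waveBlocks n) = L/‖n‖_∞ = L/‖(fun j => (n j : ℝ))‖` (sup norm; `waveBlocks n + 1 = supIdx n` for
`n ≠ 0`), the window giving `supIdx n ≤ M√ρL/2π`. Why it might fail: only measurability/`ℝ≥0∞` bookkeeping
(`iSup` unfolding needs the energy `locEnergy` finite and the `0/0` case handled). (Refs: LyonsPeres2016 Ch. 2 §2.4.) -/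
theorem stub_localOfCubePoincare : CubePoincareMoment → Children.LocalFibreConductance := by
  sorry

/-- **stub 3 — `stub_coarseBeatConductance` (OPEN, landscape-coarse CONDITIONAL on the IR input, L).**
`Children.CoarseBeatConductance` (`= ShellOccupation → ConditionalLawPoincare.CoarseBeatDualBound`, `Iff.rfl`):
given the half-shell occupation input, the block charges `c_Q` on the `‖n‖_∞³` wavelength grid have lattice
`H⁻¹(ψ²-conductance)` norm `≤ B L²/‖n‖²` (‖n‖_∞ ≥ 2). Plan = c2's original PICKED lattice plan + c1's beatCount /
coarseCages: (i) flat lattice norm diagonal in lattice Fourier modes; translation invariance of the exact ground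
state's bath law + fibre Fubini (p77085) turn it into the aliased beat sum `Σ_{0<|P|≲‖n‖_∞} s_P² n_{P−n}(|Φ|)L²/(4π²N|P|²)`,
paid by the INPUT on the resonant half-shell (lattice count `Σ_{|P|≤R}|P|⁻² ≤ 4πR`), by `Σ_p n_p = N` and the fibre
Fisher budget (`stub_kineticBudget` p100839) off it — the landed `stub_parsevalShell` (p88803) bookkeeping;
(ii) density-fluctuation term `|ĉ_{−n}|²(L³μ_Q/|Q| − 1)²` by second local-number moments (energy level);
(iii) random conductances = coarse cages at scale `ℓ ≥ 2π/(M√ρ)`: sparse bad faces + GKZ detours in Born average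
(landscape input of LNEM type at scale `ℓ`, NEVER the cell-scale Sobolev step — c3 FLAG `FlatCoarseMassMoment`).
Why it might fail: the coarse-cage half needs mixing of the non-product bath law; aliasing of `|P| ≳ ‖n‖_∞` modes
must keep the factor `s_P²`; the 4-point density term may need more than second moments.
(Refs: GrimmettKestenZhang1993; LyonsPeres2016; KennedyLiebShastry1988; LSSY2005 §1.2.) -/
theorem stub_coarseBeatConductance : Children.CoarseBeatConductance := by
  sorry

/-- **stub 4 — `stub_halfShellOccupation` (THE INFRARED INPUT; ITEM-IN-WAITING, not to be proved inside this line).**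
`Children.HalfShellOccupation` (`= ParsevalShellBootstrap.ShellOccupation` VERBATIM, `Iff.rfl`; drefuted 2026-08-16,
survived; guards ⊢ p75961/p77197). Its NECESSITY for the crux is ⊢ `infraredNecessity` (p90785) /
`singleModeOccupation_of_fibreConductance` (p126624); its only known SOURCE is the route's rank-2 crux
`GaussianDominationCan` via the `T = 0` KLS step at exact minimisers (census S5; recommended support item
`GaussianDominationCan → HalfShellOccupation`). Lead protocol: `blocked-on`/`promote-stub`, and on the final cycle the
prepared `route edit --split FibreConductance --into children.json` (card §Split). Why it might fail: thermodynamic-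
limit single-mode control of exact ground states, beyond energy methods and without reflection positivity
(ideator-4 B1–B7). (Refs: KennedyLiebShastry1988; arXiv:1211.2778; LSSY2005 Thm 2.2; PitaevskiiStringari1991.) -/
theorem stub_halfShellOccupation : Children.HalfShellOccupation := by
  sorry

/-! ## §2 Composition (kernel-checked): the four registered stubs imply the crux BY NAME -/

/-- **The crux modulo the registered stubs** (becomes the closing proof when they land):
`fibreConductance_of_cruxDualBound (cruxDualBound_of_local_coarse (stub₂ stub₁) (stub₃ stub₄))` — the local
child from the cube-Poincaré moment, the coarse beat dual bound from the IR input, the strategist's glue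
`cruxDualBound_of_local_coarse`, and the landed Thomson realisation. [folklore] -/
theorem fibreConductance_of_registered_stubs : FibreConductance :=
  fibreConductance_of_cruxDualBound
    (cruxDualBound_of_local_coarse (stub_localOfCubePoincare stub_cubePoincareMoment)
      (stub_coarseBeatConductance stub_halfShellOccupation))

/-- **The same composition with the stub STATEMENTS as hypotheses**:
`CubePoincareMoment → (CubePoincareMoment → LocalFibreConductance) → CoarseBeatConductance → HalfShellOccupation →
FibreConductance`. [folklore] -/
theorem FibreConductance_of (h₁ : CubePoincareMoment) (h₂ : CubePoincareMoment → Children.LocalFibreConductance)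
    (h₃ : Children.CoarseBeatConductance) (h₄ : Children.HalfShellOccupation) : FibreConductance :=
  fibreConductance_of_cruxDualBound (cruxDualBound_of_local_coarse (h₂ h₁) (h₃ h₄))

end Summit.AtomisticToContinuum.BoseEinsteinCondensation.Cruxes.FibreConductance.StrategistSplitLine

end
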